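import Summits.ValiantsHypothesis.ValiantsHypothesis.Theorems.KPlusLogSqLawTropicalCensusRows
import Summits.ValiantsHypothesis.ValiantsHypothesis.Theorems.KPlusLogSqLawTridiagonalRealStatic
import Summits.ValiantsHypothesis.ValiantsHypothesis.Theorems.KPlusLogSqLawTropicalBSplitDefs

/-!
# Route «KPlusLogSqLaw», crux `WeakLifting` (stmt-ValiantsHypothesis-19561) — REAL vs TROPICAL side of the tridiagonal sector:
# A UNIT-COEFFICIENT `5 × 5` DESIGN: every valuation ZERO, one dominant term on each side of slope `0`, yet THREE positive zeros

HONEST FRAMING.  Helper theorems (`--supports stmt-ValiantsHypothesis-19561 --as helper`), seat val-sym-lift-p1 (g14), cell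
`pub-symmetroid`, 2026-08-28; fifth file of the «tropical shadow» series (p596186 pump, p598473 / p599625 ladder, p600659 small silent
designs) and the KERNEL FORM OF THIS SEAT'S OWN ERRATUM (cell bus, 2026-08-28): the located candidate «real zeros ≤ 2 · (breakpoints of the
design's real-slope tropical envelope)» is FALSE, and so is its first rung «two envelope vertices ⇒ ≤ 2 zeros».  The killer is the simplest
conceivable family: ALL COEFFICIENTS EQUAL TO ONE.  Then every Leibniz term has valuation `0`, every tropical weight is `θ · (total exponent)`,
the envelope over real slopes has exactly two vertices (the terms of minimal and maximal total exponent, meeting at `θ = 0` where EVERYTHING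
ties), and nevertheless the determinant has three positive zeros at size `5` (located: `4, 5, 6` at sizes `7, 9, 12`).  One explicit design,
certificates by `decide`; nothing here is an upper bound and nothing bears on `WeakLifting` / `TropicalB` (stmt-19771) in their windows, on
Conjecture B, on the Door-A registers, on `MatrixDescartes` (stmt-18050) or on VP ≠ VNP (FORMAT-level lifting untouched; design-level structure).

THE DESIGN.  The static definite symmetric tridiagonal `5 × 5` monomial matrix with diagonal `(1, 1, X, 1, X)` and links `(X², 1, 1, 1)`, all
coefficients `1`; determinant `−X⁶ + 2X⁵ + X² − 3X + 1`, which alternates in sign at `x = 1/4, 1/2, 3/2, 2` (three positive zeros, one of them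
`x = 1` exactly — the total resonance).  Shadow: classes `d = (0, 1, 2)`, `ε = 1` on the one class of each band entry, `v ≡ 0`.  Edge data
`W = (x⁴, x⁻¹, x⁻¹, x⁻¹)`; absolute tropical weight of a matching `μ` = `θ · (2 + Σ_{k∈μ} L_k)`: the pair of links `{2,4}` (total exponent `0`,
sign `+`) is the unique optimum for every `θ ≤ −1`, the first link `{1}` (total exponent `6`, sign `−`) for every `θ ≥ 1`, and at `θ = 0` all
eight terms tie.

WHAT IS PROVED.  **`unit_five`**: `|ε| ≤ 1`; symmetric letters; CLASSIFICATION (dominant at `θ` iff `θ ≤ −1` and the term is `{2,4}`, or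
`θ ≥ 1` and it is `{1}`); signs (`+1` / `−1`); every sign-alternating dominant chain along strictly increasing integer slopes has `n ≤ 1` and
`n = 1` is attained; `DesignRowD … 1`; the base-2 patchwork pencil IS the matrix above (entry by entry); its determinant has `≥ 3` distinct positive
zeros.  `unit_five_exists` repackages it.  [this seat; certificates: session tools/cert/unit5.py; folklore: LP duality, continuants, IVT]
-/

-- `Summit.ValiantsHypothesis.ValiantsHypothesis.…` repeats a component by the D-0017 layout (single-conjunct summit); the name is mandated.
set_option linter.dupNamespace false
set_option autoImplicit false

namespace Summit.ValiantsHypothesis.ValiantsHypothesis.Theorems.KPlusLogSqLaw.StaticTridiagonalRealUnitShadow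

open Summit.ValiantsHypothesis.ValiantsHypothesis.Theorems.MatrixDescartes.Negative
open Summit.ValiantsHypothesis.ValiantsHypothesis.Theorems.LacunarySymmetroidMatrixDescartes.TropicalCensus
open Summit.ValiantsHypothesis.ValiantsHypothesis.Theorems.ValuativeFlip (ctK ctPath ctPath_apply ctK_add_two ctK_zero ctK_one)
open Summit.ValiantsHypothesis.ValiantsHypothesis.Theorems.KPlusLogSqLaw.StaticTridiagonalReal (det_ctPath)
open Summit.ValiantsHypothesis.ValiantsHypothesis.Theorems.SymmetroidDescartes (le_card_posRoots_of_alternating)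
open Finset Polynomial
open scoped BigOperators

/-- **A UNIT-COEFFICIENT DESIGN WITH TWO ENVELOPE VERTICES AND THREE POSITIVE ZEROS.**  For the explicit design `(d, v, ε)` of format `(5, 3)`
in the statement (`v ≡ 0`): `|ε| ≤ 1`; symmetric letters; a term is dominant at the integer slope `θ` iff (`θ ≤ −1` and it is the link pair
`{2,4}`) or (`θ ≥ 1` and it is the first link `{1}`); these have `termSign` `+1` and `−1`; every sign-alternating dominant chain at strictly
increasing integer slopes has `n ≤ 1`, and one with `n = 1` exists; the unsigned row is `1`; the base-2 patchwork pencil is the path matrix with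
diagonal `(1,1,X,1,X)` and links `(X²,1,1,1)`; and its determinant has at least `3` distinct positive zeros. [this file] -/
theorem unit_five :
    (∀ i j l, ((fun (a b : Fin 5) (l : Fin 3) => (if (((b : ℕ) = a ∨ (b : ℕ) = a + 1 ∨ (a : ℕ) = b + 1) ∧ l = (fun a b : Fin 5 => (if (b : ℕ) = a then (![0, 0, 1, 0, 1] : Fin 5 → Fin 3) a else if (b : ℕ) = a + 1 then (![2, 0, 0, 0, 0] : Fin 5 → Fin 3) a else if (a : ℕ) = b + 1 then (![2, 0, 0, 0, 0] : Fin 5 → Fin 3) b else 0)) a b) then (1 : ℤ) else 0)) i j l).natAbs ≤ 1) ∧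
    (∀ l, (patchMatrix 2 (fun (_ _ : Fin 5) (_ : Fin 3) => (0 : ℤ)) (fun (a b : Fin 5) (l : Fin 3) => (if (((b : ℕ) = a ∨ (b : ℕ) = a + 1 ∨ (a : ℕ) = b + 1) ∧ l = (fun a b : Fin 5 => (if (b : ℕ) = a then (![0, 0, 1, 0, 1] : Fin 5 → Fin 3) a else if (b : ℕ) = a + 1 then (![2, 0, 0, 0, 0] : Fin 5 → Fin 3) a else if (a : ℕ) = b + 1 then (![2, 0, 0, 0, 0] : Fin 5 → Fin 3) b else 0)) a b) then (1 : ℤ) else 0)) l).IsSymm) ∧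
    (∀ (θ : ℤ) (p : Equiv.Perm (Fin 5) × (Fin 5 → Fin 3)), IsDominant (![0, 1, 2] : Fin 3 → ℕ) (fun (_ _ : Fin 5) (_ : Fin 3) => (0 : ℤ)) (fun (a b : Fin 5) (l : Fin 3) => (if (((b : ℕ) = a ∨ (b : ℕ) = a + 1 ∨ (a : ℕ) = b + 1) ∧ l = (fun a b : Fin 5 => (if (b : ℕ) = a then (![0, 0, 1, 0, 1] : Fin 5 → Fin 3) a else if (b : ℕ) = a + 1 then (![2, 0, 0, 0, 0] : Fin 5 → Fin 3) a else if (a : ℕ) = b + 1 then (![2, 0, 0, 0, 0] : Fin 5 → Fin 3) b else 0)) a b) then (1 : ℤ) else 0)) θ p ↔ (θ ≤ -1 ∧ p = (((Equiv.swap (1 : Fin 5) 2 * Equiv.swap (3 : Fin 5) 4 : Equiv.Perm (Fin 5)), fun i => (fun a b : Fin 5 => (if (b : ℕ) = a then (![0, 0, 1, 0, 1] : Fin 5 → Fin 3) a else if (b : ℕ) = a + 1 then (![2, 0, 0, 0, 0] : Fin 5 → Fin 3) a else if (a : ℕ) = b + 1 then (![2, 0, 0, 0, 0] : Fin 5 →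 Fin 3) b else 0)) ((Equiv.swap (1 : Fin 5) 2 * Equiv.swap (3 : Fin 5) 4 : Equiv.Perm (Fin 5)) i) i) : Equiv.Perm (Fin 5) × (Fin 5 → Fin 3))) ∨ (1 ≤ θ ∧ p = (((Equiv.swap (0 : Fin 5) 1 : Equiv.Perm (Fin 5)), fun i => (fun a b : Fin 5 => (if (b : ℕ) = a then (![0, 0, 1, 0, 1] : Fin 5 → Fin 3) a else if (b : ℕ) = a + 1 then (![2, 0, 0, 0, 0] : Fin 5 → Fin 3) a else if (a : ℕ) = b + 1 then (![2, 0, 0, 0, 0] : Fin 5 → Fin 3) b else 0)) ((Equiv.swap (0 : Fin 5) 1 : Equiv.Perm (Fin 5)) i) i) : Equiv.Perm (Fin 5) × (Fin 5 → Fin 3)))) ∧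
    termSign (fun (a b : Fin 5) (l : Fin 3) => (if (((b : ℕ) = a ∨ (b : ℕ) = a + 1 ∨ (a : ℕ) = b + 1) ∧ l = (fun a b : Fin 5 => (if (b : ℕ) = a then (![0, 0, 1, 0, 1] : Fin 5 → Fin 3) a else if (b : ℕ) = a + 1 then (![2, 0, 0, 0, 0] : Fin 5 → Fin 3) a else if (a : ℕ) = b + 1 then (![2, 0, 0, 0, 0] : Fin 5 → Fin 3) b else 0)) a b) then (1 : ℤ) else 0)) (((Equiv.swap (1 : Fin 5) 2 * Equiv.swap (3 : Fin 5) 4 : Equiv.Perm (Fin 5)), fun i => (fun a b : Fin 5 => (if (b : ℕ) = a then (![0, 0, 1, 0, 1] : Fin 5 → Fin 3) a else if (b : ℕ) = a + 1 then (![2, 0, 0, 0, 0] : Fin 5 → Fin 3) a else if (a : ℕ) = b + 1 then (![2, 0, 0, 0, 0] : Fin 5 → Fin 3) b else 0)) ((Equiv.swap (1 : Fin 5) 2 * Equiv.swap (3 : Fin 5) 4 : Equiv.Perm (Fin 5)) i) i) : Equiv.Perm (Fin 5) × (Fin 5 → Fin 3)) = 1 ∧ termSign (fun (a b : Fin 5)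 (l : Fin 3) => (if (((b : ℕ) = a ∨ (b : ℕ) = a + 1 ∨ (a : ℕ) = b + 1) ∧ l = (fun a b : Fin 5 => (if (b : ℕ) = a then (![0, 0, 1, 0, 1] : Fin 5 → Fin 3) a else if (b : ℕ) = a + 1 then (![2, 0, 0, 0, 0] : Fin 5 → Fin 3) a else if (a : ℕ) = b + 1 then (![2, 0, 0, 0, 0] : Fin 5 → Fin 3) b else 0)) a b) then (1 : ℤ) else 0)) (((Equiv.swap (0 : Fin 5) 1 : Equiv.Perm (Fin 5)), fun i => (fun a b : Fin 5 => (if (b : ℕ) = a then (![0, 0, 1, 0, 1] : Fin 5 → Fin 3) a else if (b : ℕ) = a + 1 then (![2, 0, 0, 0, 0] : Fin 5 → Fin 3) a else if (a : ℕ) = b + 1 then (![2, 0, 0, 0, 0] : Fin 5 → Fin 3) b else 0)) ((Equiv.swap (0 : Fin 5) 1 : Equiv.Perm (Fin 5)) i) i) : Equiv.Perm (Fin 5) × (Fin 5 → Fin 3)) = -1 ∧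
    (∀ (n : ℕ) (θ : Fin (n + 1) → ℤ) (p : Fin (n + 1) → Equiv.Perm (Fin 5) × (Fin 5 → Fin 3)), StrictMono θ →
      (∀ k, IsDominant (![0, 1, 2] : Fin 3 → ℕ) (fun (_ _ : Fin 5) (_ : Fin 3) => (0 : ℤ)) (fun (a b : Fin 5) (l : Fin 3) => (if (((b : ℕ) = a ∨ (b : ℕ) = a + 1 ∨ (a : ℕ) = b + 1) ∧ l = (fun a b : Fin 5 => (if (b : ℕ) = a then (![0, 0, 1, 0, 1] : Fin 5 → Fin 3) a else if (b : ℕ) = a + 1 then (![2, 0, 0, 0, 0] : Fin 5 → Fin 3) a else if (a : ℕ) = b + 1 then (![2, 0, 0, 0, 0] : Fin 5 → Fin 3) b else 0)) a b) then (1 : ℤ) else 0)) (θ k) (p k)) →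
      (∀ k : Fin n, termSign (fun (a b : Fin 5) (l : Fin 3) => (if (((b : ℕ) = a ∨ (b : ℕ) = a + 1 ∨ (a : ℕ) = b + 1) ∧ l = (fun a b : Fin 5 => (if (b : ℕ) = a then (![0, 0, 1, 0, 1] : Fin 5 → Fin 3) a else if (b : ℕ) = a + 1 then (![2, 0, 0, 0, 0] : Fin 5 → Fin 3) a else if (a : ℕ) = b + 1 then (![2, 0, 0, 0, 0] : Fin 5 → Fin 3) b else 0)) a b) then (1 : ℤ) else 0)) (p k.castSucc) * termSign (fun (a b : Fin 5) (l : Fin 3) => (if (((b : ℕ) = a ∨ (b : ℕ) = a + 1 ∨ (a : ℕ) = b + 1) ∧ l = (fun a b : Fin 5 => (if (b : ℕ) = a then (![0, 0, 1, 0, 1] : Fin 5 → Fin 3) a else if (b : ℕ) = a + 1 then (![2, 0, 0, 0, 0] : Fin 5 → Fin 3) a else if (a : ℕ) = b + 1 then (![2, 0, 0, 0, 0] : Fin 5 → Fin 3) b else 0)) a b) then (1 : ℤ) else 0)) (p k.succ) < 0) → n ≤ 1) ∧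
    (∃ (θ : Fin 2 → ℤ) (p : Fin 2 → Equiv.Perm (Fin 5) × (Fin 5 → Fin 3)), StrictMono θ ∧ (∀ k, IsDominant (![0, 1, 2] : Fin 3 → ℕ) (fun (_ _ : Fin 5) (_ : Fin 3) => (0 : ℤ)) (fun (a b : Fin 5) (l : Fin 3) => (if (((b : ℕ) = a ∨ (b : ℕ) = a + 1 ∨ (a : ℕ) = b + 1) ∧ l = (fun a b : Fin 5 => (if (b : ℕ) = a then (![0, 0, 1, 0, 1] : Fin 5 → Fin 3) a else if (b : ℕ) = a + 1 then (![2, 0, 0, 0, 0] : Fin 5 → Fin 3) a else if (a : ℕ) = b + 1 then (![2, 0, 0, 0, 0] : Fin 5 → Fin 3) b else 0)) a b) then (1 : ℤ) else 0)) (θ k) (p k)) ∧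
      (∀ k : Fin 1, termSign (fun (a b : Fin 5) (l : Fin 3) => (if (((b : ℕ) = a ∨ (b : ℕ) = a + 1 ∨ (a : ℕ) = b + 1) ∧ l = (fun a b : Fin 5 => (if (b : ℕ) = a then (![0, 0, 1, 0, 1] : Fin 5 → Fin 3) a else if (b : ℕ) = a + 1 then (![2, 0, 0, 0, 0] : Fin 5 → Fin 3) a else if (a : ℕ) = b + 1 then (![2, 0, 0, 0, 0] : Fin 5 → Fin 3) b else 0)) a b) then (1 : ℤ) else 0)) (p k.castSucc) * termSign (fun (a b : Fin 5) (l : Fin 3) => (if (((b : ℕ) = a ∨ (b : ℕ) = a + 1 ∨ (a : ℕ) = b + 1) ∧ l = (fun a b : Fin 5 => (if (b : ℕ) = a then (![0, 0, 1, 0, 1] : Fin 5 → Fin 3) a else if (b : ℕ) = a + 1 then (![2, 0, 0, 0, 0] : Fin 5 → Fin 3) a else if (a : ℕ) = b + 1 then (![2, 0, 0, 0, 0] : Fin 5 → Fin 3) b else 0)) a b) then (1 : ℤ) else 0)) (p k.succ) < 0)) ∧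
    DesignRowD (![0, 1, 2] : Fin 3 → ℕ) (fun (_ _ : Fin 5) (_ : Fin 3) => (0 : ℤ)) (fun (a b : Fin 5) (l : Fin 3) => (if (((b : ℕ) = a ∨ (b : ℕ) = a + 1 ∨ (a : ℕ) = b + 1) ∧ l = (fun a b : Fin 5 => (if (b : ℕ) = a then (![0, 0, 1, 0, 1] : Fin 5 → Fin 3) a else if (b : ℕ) = a + 1 then (![2, 0, 0, 0, 0] : Fin 5 → Fin 3) a else if (a : ℕ) = b + 1 then (![2, 0, 0, 0, 0] : Fin 5 → Fin 3) b else 0)) a b) then (1 : ℤ) else 0)) 1 ∧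
    (∑ l, (X : ℝ[X]) ^ (![0, 1, 2] : Fin 3 → ℕ) l • (patchMatrix 2 (fun (_ _ : Fin 5) (_ : Fin 3) => (0 : ℤ)) (fun (a b : Fin 5) (l : Fin 3) => (if (((b : ℕ) = a ∨ (b : ℕ) = a + 1 ∨ (a : ℕ) = b + 1) ∧ l = (fun a b : Fin 5 => (if (b : ℕ) = a then (![0, 0, 1, 0, 1] : Fin 5 → Fin 3) a else if (b : ℕ) = a + 1 then (![2, 0, 0, 0, 0] : Fin 5 → Fin 3) a else if (a : ℕ) = b + 1 then (![2, 0, 0, 0, 0] : Fin 5 → Fin 3) b else 0)) a b) then (1 : ℤ) else 0)) l).map C) =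
      (ctPath
        (fun t : ℕ => if t = 2 then (X : ℝ[X]) else if t = 4 then (X : ℝ[X]) else (1 : ℝ[X]))
        (fun t : ℕ => if t = 0 then (X ^ 2 : ℝ[X]) else if t = 1 then (1 : ℝ[X]) else if t = 2 then (1 : ℝ[X]) else if t = 3 then (1 : ℝ[X]) else (0 : ℝ[X]))
        (fun t : ℕ => if t = 0 then (0 : ℝ[X]) else if t = 1 then (X ^ 2 : ℝ[X]) else if t = 2 then (1 : ℝ[X]) else if t = 3 then (1 : ℝ[X]) else if t = 4 then (1 : ℝ[X]) else (0 : ℝ[X])) 5) ∧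
    3 ≤ (((ctPath
        (fun t : ℕ => if t = 2 then (X : ℝ[X]) else if t = 4 then (X : ℝ[X]) else (1 : ℝ[X]))
        (fun t : ℕ => if t = 0 then (X ^ 2 : ℝ[X]) else if t = 1 then (1 : ℝ[X]) else if t = 2 then (1 : ℝ[X]) else if t = 3 then (1 : ℝ[X]) else (0 : ℝ[X]))
        (fun t : ℕ => if t = 0 then (0 : ℝ[X]) else if t = 1 then (X ^ 2 : ℝ[X]) else if t = 2 then (1 : ℝ[X]) else if t = 3 then (1 : ℝ[X]) else if t = 4 then (1 : ℝ[X]) else (0 : ℝ[X])) 5)).det.roots.toFinset.filter (fun t => 0 < t)).card := by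
  -- generic steps (local copies of `…PumpShadow`'s tools)
  have sum_le_of_potential : ∀ (ε : Fin 5 → Fin 5 → Fin 3 → ℤ) (g : Fin 5 → Fin 5 → Fin 3 → ℤ) (u w : Fin 5 → ℤ),
      (∀ a b l, ε a b l ≠ 0 → g a b l ≤ u a + w b) → ∀ p : Equiv.Perm (Fin 5) × (Fin 5 → Fin 3), termSign ε p ≠ 0 → ∀ V : ℤ, ∑ a, u a + ∑ b, w b ≤ V →
      ∑ i, g (p.1 i) i (p.2 i) ≤ V := by
    intro ε g u w h p hp V hV
    calc ∑ i, g (p.1 i) i (p.2 i) ≤ ∑ i, (u (p.1 i) + w i) :=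
          Finset.sum_le_sum fun i _ => h _ _ _ (present_of_termSign_ne_zero ε p hp i)
      _ = ∑ a, u a + ∑ b, w b := by rw [Finset.sum_add_distrib, Equiv.sum_comp p.1 u]
      _ ≤ V := hV
  have tropWeight_affine : ∀ (θ θ₀ : ℤ) (p : Equiv.Perm (Fin 5) × (Fin 5 → Fin 3)),
      tropWeight (![0, 1, 2] : Fin 3 → ℕ) (fun (_ _ : Fin 5) (_ : Fin 3) => (0 : ℤ)) θ p = tropWeight (![0, 1, 2] : Fin 3 → ℕ) (fun (_ _ : Fin 5) (_ : Fin 3) => (0 : ℤ)) θ₀ p + (θ - θ₀) * ∑ i, ((![0, 1, 2] : Fin 3 → ℕ) (p.2 i) : ℤ) := by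
    intro θ θ₀ p
    unfold tropWeight
    ring
  have eq_of_isDominant : ∀ (θ : ℤ) (p q : Equiv.Perm (Fin 5) × (Fin 5 → Fin 3)), IsDominant (![0, 1, 2] : Fin 3 → ℕ) (fun (_ _ : Fin 5) (_ : Fin 3) => (0 : ℤ)) (fun (a b : Fin 5) (l : Fin 3) => (if (((b : ℕ) = a ∨ (b : ℕ) = a + 1 ∨ (a : ℕ) = b + 1) ∧ l = (fun a b : Fin 5 => (if (b : ℕ) = a then (![0, 0, 1, 0, 1] : Fin 5 → Fin 3) a else if (b : ℕ) = a + 1 then (![2, 0, 0, 0, 0] : Fin 5 → Fin 3) a else if (a : ℕ) = b + 1 then (![2, 0, 0, 0, 0] : Fin 5 → Fin 3) b else 0)) a b) then (1 : ℤ) else 0)) θ p → IsDominant (![0, 1, 2] : Fin 3 → ℕ) (fun (_ _ : Fin 5) (_ : Fin 3) => (0 : ℤ)) (fun (a b : Fin 5) (l : Fin 3) => (if (((b : ℕ) = a ∨ (b : ℕ) = a + 1 ∨ (a : ℕ) = b + 1) ∧ l = (fun a b : Fin 5 => (if (b : ℕ) = a then (![0, 0, 1, 0, 1] : Fin 5 →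 Fin 3) a else if (b : ℕ) = a + 1 then (![2, 0, 0, 0, 0] : Fin 5 → Fin 3) a else if (a : ℕ) = b + 1 then (![2, 0, 0, 0, 0] : Fin 5 → Fin 3) b else 0)) a b) then (1 : ℤ) else 0)) θ q → p = q := by
    intro θ p q hp hq
    by_contra hne
    exact lt_asymm (hp.2 q (Ne.symm hne) hq.1) (hq.2 p hne hp.1)
  -- (a) strict certificates at `θ = 1` (`{1}`) and `θ = −1` (`{2,4}`)
  have hplus : IsDominant (![0, 1, 2] : Fin 3 → ℕ) (fun (_ _ : Fin 5) (_ : Fin 3) => (0 : ℤ)) (fun (a b : Fin 5) (l : Fin 3) => (if (((b : ℕ) = a ∨ (b : ℕ) = a + 1 ∨ (a : ℕ) = b + 1) ∧ l = (fun a b : Fin 5 => (if (b : ℕ) = a then (![0, 0, 1, 0, 1] : Fin 5 → Fin 3) a else if (b : ℕ) = a + 1 then (![2, 0, 0, 0, 0] : Fin 5 → Fin 3) a else if (a : ℕ) = b + 1 then (![2, 0, 0, 0, 0] : Fin 5 → Fin 3) b else 0)) a b) then (1 : ℤ) else 0)) 1 (((Equiv.swap (0 : Fin 5) 1 : Equiv.Perm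 (Fin 5)), fun i => (fun a b : Fin 5 => (if (b : ℕ) = a then (![0, 0, 1, 0, 1] : Fin 5 → Fin 3) a else if (b : ℕ) = a + 1 then (![2, 0, 0, 0, 0] : Fin 5 → Fin 3) a else if (a : ℕ) = b + 1 then (![2, 0, 0, 0, 0] : Fin 5 → Fin 3) b else 0)) ((Equiv.swap (0 : Fin 5) 1 : Equiv.Perm (Fin 5)) i) i) : Equiv.Perm (Fin 5) × (Fin 5 → Fin 3)) :=
    isDominant_of_scaledPotential _ _ _ 1 (Equiv.swap (0 : Fin 5) 1 : Equiv.Perm (Fin 5)) (fun i => (fun a b : Fin 5 => (if (b : ℕ) = a then (![0, 0, 1, 0, 1] : Fin 5 → Fin 3) a else if (b : ℕ) = a + 1 then (![2, 0, 0, 0, 0] : Fin 5 → Fin 3) a else if (a : ℕ) = b + 1 then (![2, 0, 0, 0, 0] : Fin 5 → Fin 3) b else 0)) ((Equiv.swap (0 : Fin 5) 1 : Equiv.Perm (Fin 5)) i) i) 4 (by norm_num) (![0, 0, 1, 0, 1] : Fin 5 → ℤ) (![8, 8, 3, 0, 3] : Fin 5 → ℤ)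
      (by decide +kernel) (by decide +kernel) (by decide +kernel)
  have hminus : IsDominant (![0, 1, 2] : Fin 3 → ℕ) (fun (_ _ : Fin 5) (_ : Fin 3) => (0 : ℤ)) (fun (a b : Fin 5) (l : Fin 3) => (if (((b : ℕ) = a ∨ (b : ℕ) = a + 1 ∨ (a : ℕ) = b + 1) ∧ l = (fun a b : Fin 5 => (if (b : ℕ) = a then (![0, 0, 1, 0, 1] : Fin 5 → Fin 3) a else if (b : ℕ) = a + 1 then (![2, 0, 0, 0, 0] : Fin 5 → Fin 3) a else if (a : ℕ) = b + 1 then (![2, 0, 0, 0, 0] : Fin 5 → Fin 3) b else 0)) a b) then (1 : ℤ) else 0)) (-1) (((Equiv.swap (1 : Fin 5) 2 * Equiv.swap (3 : Fin 5) 4 : Equiv.Perm (Fin 5)), fun i => (fun a b : Fin 5 => (if (b : ℕ) = a then (![0, 0, 1, 0, 1] : Fin 5 → Fin 3) a else if (b : ℕ) = a + 1 then (![2, 0, 0, 0, 0] : Fin 5 → Fin 3) a else if (a : ℕ) = b + 1 then (![2, 0, 0, 0, 0] : Fin 5 → Fin 3) b else 0)) ((Equiv.swap (1 : Fin 5) 2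 * Equiv.swap (3 : Fin 5) 4 : Equiv.Perm (Fin 5)) i) i) : Equiv.Perm (Fin 5) × (Fin 5 → Fin 3)) :=
    isDominant_of_scaledPotential _ _ _ (-1) (Equiv.swap (1 : Fin 5) 2 * Equiv.swap (3 : Fin 5) 4 : Equiv.Perm (Fin 5)) (fun i => (fun a b : Fin 5 => (if (b : ℕ) = a then (![0, 0, 1, 0, 1] : Fin 5 → Fin 3) a else if (b : ℕ) = a + 1 then (![2, 0, 0, 0, 0] : Fin 5 → Fin 3) a else if (a : ℕ) = b + 1 then (![2, 0, 0, 0, 0] : Fin 5 → Fin 3) b else 0)) ((Equiv.swap (1 : Fin 5) 2 * Equiv.swap (3 : Fin 5) 4 : Equiv.Perm (Fin 5)) i) i) 8 (by norm_num) (![0, 2, 1, 3, 0] : Fin 5 → ℤ) (![0, -1, -2, 0, -3] : Fin 5 → ℤ)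
      (by decide +kernel) (by decide +kernel) (by decide +kernel)
  -- (b) extremal total exponents: `0 ≤ ∑ d ≤ 6`, attained by `{2,4}` and `{1}`
  have hsmax : ∀ p : Equiv.Perm (Fin 5) × (Fin 5 → Fin 3), termSign (fun (a b : Fin 5) (l : Fin 3) => (if (((b : ℕ) = a ∨ (b : ℕ) = a + 1 ∨ (a : ℕ) = b + 1) ∧ l = (fun a b : Fin 5 => (if (b : ℕ) = a then (![0, 0, 1, 0, 1] : Fin 5 → Fin 3) a else if (b : ℕ) = a + 1 then (![2, 0, 0, 0, 0] : Fin 5 → Fin 3) a else if (a : ℕ) = b + 1 then (![2, 0, 0, 0, 0] : Fin 5 → Fin 3) b else 0)) a b) then (1 : ℤ) else 0)) p ≠ 0 → ∑ i, ((![0, 1, 2] : Fin 3 → ℕ) (p.2 i) : ℤ) ≤ ∑ i, ((![0, 1, 2] : Fin 3 → ℕ) (((((Equiv.swap (0 : Fin 5) 1 : Equiv.Perm (Fin 5)), fun i => (fun a b : Fin 5 => (if (b : ℕ) = a then (![0, 0, 1, 0, 1] : Fin 5 → Fin 3) a else if (b : ℕ) = a + 1 then (![2, 0, 0, 0, 0]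 : Fin 5 → Fin 3) a else if (a : ℕ) = b + 1 then (![2, 0, 0, 0, 0] : Fin 5 → Fin 3) b else 0)) ((Equiv.swap (0 : Fin 5) 1 : Equiv.Perm (Fin 5)) i) i) : Equiv.Perm (Fin 5) × (Fin 5 → Fin 3))).2 i) : ℤ) := by
    intro p hp
    have hs : ∑ i, ((![0, 1, 2] : Fin 3 → ℕ) (((((Equiv.swap (0 : Fin 5) 1 : Equiv.Perm (Fin 5)), fun i => (fun a b : Fin 5 => (if (b : ℕ) = a then (![0, 0, 1, 0, 1] : Fin 5 → Fin 3) a else if (b : ℕ) = a + 1 then (![2, 0, 0, 0, 0] : Fin 5 → Fin 3) a else if (a : ℕ) = b + 1 then (![2, 0, 0, 0, 0] : Fin 5 → Fin 3) b else 0)) ((Equiv.swap (0 : Fin 5) 1 : Equiv.Perm (Fin 5)) i) i) : Equiv.Perm (Fin 5) × (Fin 5 → Fin 3))).2 i) : ℤ) = 6 := by decide +kernel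
    rw [hs]
    exact sum_le_of_potential (fun (a b : Fin 5) (l : Fin 3) => (if (((b : ℕ) = a ∨ (b : ℕ) = a + 1 ∨ (a : ℕ) = b + 1) ∧ l = (fun a b : Fin 5 => (if (b : ℕ) = a then (![0, 0, 1, 0, 1] : Fin 5 → Fin 3) a else if (b : ℕ) = a + 1 then (![2, 0, 0, 0, 0] : Fin 5 → Fin 3) a else if (a : ℕ) = b + 1 then (![2, 0, 0, 0, 0] : Fin 5 → Fin 3) b else 0)) a b) then (1 : ℤ) else 0)) (fun _ _ l => ((![0, 1, 2] : Fin 3 → ℕ) l : ℤ)) (fun _ : Fin 5 => (0 : ℤ)) (![2, 2, 1, 0, 1] : Fin 5 → ℤ) (by decide +kernel) p hp 6 (by decide +kernel)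
  have hsmin : ∀ p : Equiv.Perm (Fin 5) × (Fin 5 → Fin 3), termSign (fun (a b : Fin 5) (l : Fin 3) => (if (((b : ℕ) = a ∨ (b : ℕ) = a + 1 ∨ (a : ℕ) = b + 1) ∧ l = (fun a b : Fin 5 => (if (b : ℕ) = a then (![0, 0, 1, 0, 1] : Fin 5 → Fin 3) a else if (b : ℕ) = a + 1 then (![2, 0, 0, 0, 0] : Fin 5 → Fin 3) a else if (a : ℕ) = b + 1 then (![2, 0, 0, 0, 0] : Fin 5 → Fin 3) b else 0)) a b) then (1 : ℤ) else 0)) p ≠ 0 → ∑ i, ((![0, 1, 2] : Fin 3 → ℕ) (((((Equiv.swap (1 : Fin 5) 2 * Equiv.swap (3 : Fin 5) 4 : Equiv.Perm (Fin 5)), fun i => (fun a b : Fin 5 => (if (b : ℕ) = a then (![0, 0, 1, 0, 1] : Fin 5 → Fin 3) a else if (b : ℕ) = a + 1 then (![2, 0, 0, 0, 0] : Fin 5 → Fin 3) a else if (a : ℕ) = b + 1 then (![2, 0, 0, 0, 0] : Fin 5 → Fin 3) b else 0)) ((Equiv.swap (1 : Fin 5) 2 * Equiv.swap (3 : Fin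 5) 4 : Equiv.Perm (Fin 5)) i) i) : Equiv.Perm (Fin 5) × (Fin 5 → Fin 3))).2 i) : ℤ) ≤ ∑ i, ((![0, 1, 2] : Fin 3 → ℕ) (p.2 i) : ℤ) := by
    intro p hp
    have hs : ∑ i, ((![0, 1, 2] : Fin 3 → ℕ) (((((Equiv.swap (1 : Fin 5) 2 * Equiv.swap (3 : Fin 5) 4 : Equiv.Perm (Fin 5)), fun i => (fun a b : Fin 5 => (if (b : ℕ) = a then (![0, 0, 1, 0, 1] : Fin 5 → Fin 3) a else if (b : ℕ) = a + 1 then (![2, 0, 0, 0, 0] : Fin 5 → Fin 3) a else if (a : ℕ) = b + 1 then (![2, 0, 0, 0, 0] : Fin 5 → Fin 3) b else 0)) ((Equiv.swap (1 : Fin 5) 2 * Equiv.swap (3 : Fin 5) 4 : Equiv.Perm (Fin 5)) i) i) : Equiv.Perm (Fin 5) × (Fin 5 → Fin 3))).2 i) : ℤ) = 0 := by decide +kernel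
    have h := sum_le_of_potential (fun (a b : Fin 5) (l : Fin 3) => (if (((b : ℕ) = a ∨ (b : ℕ) = a + 1 ∨ (a : ℕ) = b + 1) ∧ l = (fun a b : Fin 5 => (if (b : ℕ) = a then (![0, 0, 1, 0, 1] : Fin 5 → Fin 3) a else if (b : ℕ) = a + 1 then (![2, 0, 0, 0, 0] : Fin 5 → Fin 3) a else if (a : ℕ) = b + 1 then (![2, 0, 0, 0, 0] : Fin 5 → Fin 3) b else 0)) a b) then (1 : ℤ) else 0)) (fun _ _ l => -((![0, 1, 2] : Fin 3 → ℕ) l : ℤ)) (fun _ : Fin 5 => (0 : ℤ)) (fun _ : Fin 5 => (0 : ℤ)) (by decide +kernel) p hp 0 (by decide +kernel)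
    rw [Finset.sum_neg_distrib] at h
    rw [hs]
    linarith
  -- (c) the total tie at `θ = 0`
  have htie0 : ∀ p : Equiv.Perm (Fin 5) × (Fin 5 → Fin 3), ¬ IsDominant (![0, 1, 2] : Fin 3 → ℕ) (fun (_ _ : Fin 5) (_ : Fin 3) => (0 : ℤ)) (fun (a b : Fin 5) (l : Fin 3) => (if (((b : ℕ) = a ∨ (b : ℕ) = a + 1 ∨ (a : ℕ) = b + 1) ∧ l = (fun a b : Fin 5 => (if (b : ℕ) = a then (![0, 0, 1, 0, 1] : Fin 5 → Fin 3) a else if (b : ℕ) = a + 1 then (![2, 0, 0, 0, 0] : Fin 5 → Fin 3) a else if (a : ℕ) = b + 1 then (![2, 0, 0, 0, 0] : Fin 5 → Fin 3) b else 0)) a b) then (1 : ℤ) else 0)) 0 p := by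
    have hV : ∀ p : Equiv.Perm (Fin 5) × (Fin 5 → Fin 3), termSign (fun (a b : Fin 5) (l : Fin 3) => (if (((b : ℕ) = a ∨ (b : ℕ) = a + 1 ∨ (a : ℕ) = b + 1) ∧ l = (fun a b : Fin 5 => (if (b : ℕ) = a then (![0, 0, 1, 0, 1] : Fin 5 → Fin 3) a else if (b : ℕ) = a + 1 then (![2, 0, 0, 0, 0] : Fin 5 → Fin 3) a else if (a : ℕ) = b + 1 then (![2, 0, 0, 0, 0] : Fin 5 → Fin 3) b else 0)) a b) then (1 : ℤ) else 0)) p ≠ 0 → tropWeight (![0, 1, 2] : Fin 3 → ℕ) (fun (_ _ : Fin 5) (_ : Fin 3) => (0 : ℤ)) 0 p ≤ 0 := by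
      intro p hp
      rw [tropWeight_eq_sum]
      exact sum_le_of_potential (fun (a b : Fin 5) (l : Fin 3) => (if (((b : ℕ) = a ∨ (b : ℕ) = a + 1 ∨ (a : ℕ) = b + 1) ∧ l = (fun a b : Fin 5 => (if (b : ℕ) = a then (![0, 0, 1, 0, 1] : Fin 5 → Fin 3) a else if (b : ℕ) = a + 1 then (![2, 0, 0, 0, 0] : Fin 5 → Fin 3) a else if (a : ℕ) = b + 1 then (![2, 0, 0, 0, 0] : Fin 5 → Fin 3) b else 0)) a b) then (1 : ℤ) else 0)) (fun a b l => 0 * ((![0, 1, 2] : Fin 3 → ℕ) l : ℤ) - (fun (_ _ : Fin 5) (_ : Fin 3) => (0 : ℤ)) a b l) (fun _ : Fin 5 => (0 : ℤ)) (fun _ : Fin 5 => (0 : ℤ)) (by decide +kernel) p hp 0 (by decide +kernel)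
    have hne : (((1 : Equiv.Perm (Fin 5)), fun i => (fun a b : Fin 5 => (if (b : ℕ) = a then (![0, 0, 1, 0, 1] : Fin 5 → Fin 3) a else if (b : ℕ) = a + 1 then (![2, 0, 0, 0, 0] : Fin 5 → Fin 3) a else if (a : ℕ) = b + 1 then (![2, 0, 0, 0, 0] : Fin 5 → Fin 3) b else 0)) i i) : Equiv.Perm (Fin 5) × (Fin 5 → Fin 3)) ≠ (((Equiv.swap (0 : Fin 5) 1 : Equiv.Perm (Fin 5)), fun i => (fun a b : Fin 5 => (if (b : ℕ) = a then (![0, 0, 1, 0, 1] : Fin 5 → Fin 3) a else if (b : ℕ) = a + 1 then (![2, 0, 0, 0, 0] : Fin 5 → Fin 3) a else if (a : ℕ) = b + 1 then (![2, 0, 0, 0, 0] : Fin 5 → Fin 3) b else 0)) ((Equiv.swap (0 : Fin 5) 1 : Equiv.Perm (Fin 5)) i) i) : Equiv.Perm (Fin 5) × (Fin 5 → Fin 3)) := by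
      intro h
      have h1 := congrArg (fun q : Equiv.Perm (Fin 5) × (Fin 5 → Fin 3) => q.1 0) h
      revert h1
      decide +kernel
    have h₁ : termSign (fun (a b : Fin 5) (l : Fin 3) => (if (((b : ℕ) = a ∨ (b : ℕ) = a + 1 ∨ (a : ℕ) = b + 1) ∧ l = (fun a b : Fin 5 => (if (b : ℕ) = a then (![0, 0, 1, 0, 1] : Fin 5 → Fin 3) a else if (b : ℕ) = a + 1 then (![2, 0, 0, 0, 0] : Fin 5 → Fin 3) a else if (a : ℕ) = b + 1 then (![2, 0, 0, 0, 0] : Fin 5 → Fin 3) b else 0)) a b) then (1 : ℤ) else 0)) (((1 : Equiv.Perm (Fin 5)), fun i => (fun a b : Fin 5 => (if (b : ℕ) = a then (![0, 0, 1, 0, 1] : Fin 5 → Fin 3) a else if (b : ℕ) = a + 1 then (![2, 0, 0, 0, 0] : Fin 5 → Fin 3) a else if (a : ℕ) = b + 1 then (![2, 0, 0, 0, 0] : Fin 5 → Fin 3) b else 0)) i i) : Equiv.Perm (Fin 5) × (Fin 5 → Fin 3)) ≠ 0 := mul_ne_zero (Units.ne_zero _) (by decide +kernel)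
    have w₁ : tropWeight (![0, 1, 2] : Fin 3 → ℕ) (fun (_ _ : Fin 5) (_ : Fin 3) => (0 : ℤ)) 0 (((1 : Equiv.Perm (Fin 5)), fun i => (fun a b : Fin 5 => (if (b : ℕ) = a then (![0, 0, 1, 0, 1] : Fin 5 → Fin 3) a else if (b : ℕ) = a + 1 then (![2, 0, 0, 0, 0] : Fin 5 → Fin 3) a else if (a : ℕ) = b + 1 then (![2, 0, 0, 0, 0] : Fin 5 → Fin 3) b else 0)) i i) : Equiv.Perm (Fin 5) × (Fin 5 → Fin 3)) = 0 := by decide +kernel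
    have w₂ : tropWeight (![0, 1, 2] : Fin 3 → ℕ) (fun (_ _ : Fin 5) (_ : Fin 3) => (0 : ℤ)) 0 (((Equiv.swap (0 : Fin 5) 1 : Equiv.Perm (Fin 5)), fun i => (fun a b : Fin 5 => (if (b : ℕ) = a then (![0, 0, 1, 0, 1] : Fin 5 → Fin 3) a else if (b : ℕ) = a + 1 then (![2, 0, 0, 0, 0] : Fin 5 → Fin 3) a else if (a : ℕ) = b + 1 then (![2, 0, 0, 0, 0] : Fin 5 → Fin 3) b else 0)) ((Equiv.swap (0 : Fin 5) 1 : Equiv.Perm (Fin 5)) i) i) : Equiv.Perm (Fin 5) × (Fin 5 → Fin 3)) = 0 := by decide +kernel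
    intro p hp
    by_cases h : p = (((1 : Equiv.Perm (Fin 5)), fun i => (fun a b : Fin 5 => (if (b : ℕ) = a then (![0, 0, 1, 0, 1] : Fin 5 → Fin 3) a else if (b : ℕ) = a + 1 then (![2, 0, 0, 0, 0] : Fin 5 → Fin 3) a else if (a : ℕ) = b + 1 then (![2, 0, 0, 0, 0] : Fin 5 → Fin 3) b else 0)) i i) : Equiv.Perm (Fin 5) × (Fin 5 → Fin 3))
    · subst h
      have := hp.2 (((Equiv.swap (0 : Fin 5) 1 : Equiv.Perm (Fin 5)), fun i => (fun a b : Fin 5 => (if (b : ℕ) = a then (![0, 0, 1, 0, 1] : Fin 5 → Fin 3) a else if (b : ℕ) = a + 1 then (![2, 0, 0, 0, 0] : Fin 5 → Fin 3) a else if (a : ℕ) = b + 1 then (![2, 0, 0, 0, 0] : Fin 5 → Fin 3) b else 0)) ((Equiv.swap (0 : Fin 5) 1 : Equiv.Perm (Fin 5)) i) i) : Equiv.Perm (Fin 5) × (Fin 5 → Fin 3)) (Ne.symm hne) hplus.1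
      rw [w₁, w₂] at this
      exact lt_irrefl _ this
    · have h3 := hp.2 (((1 : Equiv.Perm (Fin 5)), fun i => (fun a b : Fin 5 => (if (b : ℕ) = a then (![0, 0, 1, 0, 1] : Fin 5 → Fin 3) a else if (b : ℕ) = a + 1 then (![2, 0, 0, 0, 0] : Fin 5 → Fin 3) a else if (a : ℕ) = b + 1 then (![2, 0, 0, 0, 0] : Fin 5 → Fin 3) b else 0)) i i) : Equiv.Perm (Fin 5) × (Fin 5 → Fin 3)) (Ne.symm h) h₁
      have h4 := hV p hp.1
      rw [w₁] at h3
      exact absurd (lt_of_lt_of_le h3 h4) (lt_irrefl _)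
  -- (d) classification
  have hclass : ∀ (θ : ℤ) (p : Equiv.Perm (Fin 5) × (Fin 5 → Fin 3)), IsDominant (![0, 1, 2] : Fin 3 → ℕ) (fun (_ _ : Fin 5) (_ : Fin 3) => (0 : ℤ)) (fun (a b : Fin 5) (l : Fin 3) => (if (((b : ℕ) = a ∨ (b : ℕ) = a + 1 ∨ (a : ℕ) = b + 1) ∧ l = (fun a b : Fin 5 => (if (b : ℕ) = a then (![0, 0, 1, 0, 1] : Fin 5 → Fin 3) a else if (b : ℕ) = a + 1 then (![2, 0, 0, 0, 0] : Fin 5 → Fin 3) a else if (a : ℕ) = b + 1 then (![2, 0, 0, 0, 0] : Fin 5 → Fin 3) b else 0)) a b) then (1 : ℤ) else 0)) θ p ↔ (θ ≤ -1 ∧ p = (((Equiv.swap (1 : Fin 5) 2 * Equiv.swap (3 : Fin 5) 4 : Equiv.Perm (Fin 5)), fun i => (fun a b : Fin 5 => (if (b : ℕ) = a then (![0, 0, 1, 0, 1] : Fin 5 → Fin 3) a else if (b : ℕ) = a + 1 then (![2, 0, 0, 0, 0] : Fin 5 → Fin 3) a else if (a : ℕ) = b + 1 then (![2, 0, 0,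 0, 0] : Fin 5 → Fin 3) b else 0)) ((Equiv.swap (1 : Fin 5) 2 * Equiv.swap (3 : Fin 5) 4 : Equiv.Perm (Fin 5)) i) i) : Equiv.Perm (Fin 5) × (Fin 5 → Fin 3))) ∨ (1 ≤ θ ∧ p = (((Equiv.swap (0 : Fin 5) 1 : Equiv.Perm (Fin 5)), fun i => (fun a b : Fin 5 => (if (b : ℕ) = a then (![0, 0, 1, 0, 1] : Fin 5 → Fin 3) a else if (b : ℕ) = a + 1 then (![2, 0, 0, 0, 0] : Fin 5 → Fin 3) a else if (a : ℕ) = b + 1 then (![2, 0, 0, 0, 0] : Fin 5 → Fin 3) b else 0)) ((Equiv.swap (0 : Fin 5) 1 : Equiv.Perm (Fin 5)) i) i) : Equiv.Perm (Fin 5) × (Fin 5 → Fin 3))) := by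
    intro θ p
    constructor
    · intro hp
      rcases le_or_gt θ (-1) with h | h
      · refine Or.inl ⟨h, eq_of_isDominant θ _ _ hp ⟨hminus.1, fun q hq hq' => ?_⟩⟩
        have e1 := hminus.2 q hq hq'
        rw [tropWeight_affine θ (-1) q, tropWeight_affine θ (-1)]
        have e3 : (-1 - θ) * ∑ i, ((![0, 1, 2] : Fin 3 → ℕ) (((((Equiv.swap (1 : Fin 5) 2 * Equiv.swap (3 : Fin 5) 4 : Equiv.Perm (Fin 5)), fun i => (fun a b : Fin 5 => (if (b : ℕ) = a then (![0, 0, 1, 0, 1] : Fin 5 → Fin 3) a else if (b : ℕ) = a + 1 then (![2, 0, 0, 0, 0] : Fin 5 → Fin 3) a else if (a : ℕ) = b + 1 then (![2, 0, 0, 0, 0] : Fin 5 → Fin 3) b else 0)) ((Equiv.swap (1 : Fin 5) 2 * Equiv.swap (3 : Fin 5) 4 : Equiv.Perm (Fin 5)) i) i) : Equiv.Perm (Fin 5) × (Fin 5 → Fin 3))).2 i) : ℤ) ≤ (-1 - θ) * ∑ i, ((![0, 1, 2] : Fin 3 → ℕ) (q.2 i) : ℤ) :=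
          mul_le_mul_of_nonneg_left (hsmin q hq') (by linarith)
        linarith
      rcases le_or_gt 1 θ with h' | h'
      · refine Or.inr ⟨h', eq_of_isDominant θ _ _ hp ⟨hplus.1, fun q hq hq' => ?_⟩⟩
        have e1 := hplus.2 q hq hq'
        rw [tropWeight_affine θ 1 q, tropWeight_affine θ 1]
        have e3 : (θ - 1) * ∑ i, ((![0, 1, 2] : Fin 3 → ℕ) (q.2 i) : ℤ) ≤ (θ - 1) * ∑ i, ((![0, 1, 2] : Fin 3 → ℕ) (((((Equiv.swap (0 : Fin 5) 1 : Equiv.Perm (Fin 5)), fun i => (fun a b : Fin 5 => (if (b : ℕ) = a then (![0, 0, 1, 0, 1] : Fin 5 → Fin 3) a else if (b : ℕ) = a + 1 then (![2, 0, 0, 0, 0] : Fin 5 → Fin 3) a else if (a : ℕ) = b + 1 then (![2, 0, 0, 0, 0] : Fin 5 → Fin 3) b else 0)) ((Equiv.swap (0 : Fin 5) 1 : Equiv.Perm (Fin 5)) i) i) : Equiv.Perm (Fin 5) × (Fin 5 → Fin 3))).2 i) : ℤ) :=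
          mul_le_mul_of_nonneg_left (hsmax q hq') (by linarith)
        linarith
      · exfalso
        have hθ : θ = 0 := by omega
        subst hθ
        exact htie0 p hp
    · rintro (⟨h, rfl⟩ | ⟨h, rfl⟩)
      · refine ⟨hminus.1, fun q hq hq' => ?_⟩
        have e1 := hminus.2 q hq hq'
        rw [tropWeight_affine θ (-1) q, tropWeight_affine θ (-1)]
        have e3 : (-1 - θ) * ∑ i, ((![0, 1, 2] : Fin 3 → ℕ) (((((Equiv.swap (1 : Fin 5) 2 * Equiv.swap (3 : Fin 5) 4 : Equiv.Perm (Fin 5)), fun i => (fun a b : Fin 5 => (if (b : ℕ) = a then (![0, 0, 1, 0, 1] : Fin 5 → Fin 3) a else if (b : ℕ) = a + 1 then (![2, 0, 0, 0, 0] : Fin 5 → Fin 3) a else if (a : ℕ) = b + 1 then (![2, 0, 0, 0, 0] : Fin 5 → Fin 3) b else 0)) ((Equiv.swap (1 : Fin 5) 2 * Equiv.swap (3 : Fin 5) 4 : Equiv.Perm (Fin 5)) i) i) : Equiv.Perm (Fin 5) × (Fin 5 → Fin 3))).2 i) : ℤ) ≤ (-1 - θ) * ∑ i, ((![0, 1,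 2] : Fin 3 → ℕ) (q.2 i) : ℤ) :=
          mul_le_mul_of_nonneg_left (hsmin q hq') (by linarith)
        linarith
      · refine ⟨hplus.1, fun q hq hq' => ?_⟩
        have e1 := hplus.2 q hq hq'
        rw [tropWeight_affine θ 1 q, tropWeight_affine θ 1]
        have e3 : (θ - 1) * ∑ i, ((![0, 1, 2] : Fin 3 → ℕ) (q.2 i) : ℤ) ≤ (θ - 1) * ∑ i, ((![0, 1, 2] : Fin 3 → ℕ) (((((Equiv.swap (0 : Fin 5) 1 : Equiv.Perm (Fin 5)), fun i => (fun a b : Fin 5 => (if (b : ℕ) = a then (![0, 0, 1, 0, 1] : Fin 5 → Fin 3) a else if (b : ℕ) = a + 1 then (![2, 0, 0, 0, 0] : Fin 5 → Fin 3) a else if (a : ℕ) = b + 1 then (![2, 0, 0, 0, 0] : Fin 5 → Fin 3) b else 0)) ((Equiv.swap (0 : Fin 5) 1 : Equiv.Perm (Fin 5)) i) i) : Equiv.Perm (Fin 5) × (Fin 5 → Fin 3))).2 i) : ℤ) :=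
          mul_le_mul_of_nonneg_left (hsmax q hq') (by linarith)
        linarith
  -- (e) signs
  have sM : termSign (fun (a b : Fin 5) (l : Fin 3) => (if (((b : ℕ) = a ∨ (b : ℕ) = a + 1 ∨ (a : ℕ) = b + 1) ∧ l = (fun a b : Fin 5 => (if (b : ℕ) = a then (![0, 0, 1, 0, 1] : Fin 5 → Fin 3) a else if (b : ℕ) = a + 1 then (![2, 0, 0, 0, 0] : Fin 5 → Fin 3) a else if (a : ℕ) = b + 1 then (![2, 0, 0, 0, 0] : Fin 5 → Fin 3) b else 0)) a b) then (1 : ℤ) else 0)) (((Equiv.swap (1 : Fin 5) 2 * Equiv.swap (3 : Fin 5) 4 : Equiv.Perm (Fin 5)), fun i => (fun a b : Fin 5 => (if (b : ℕ) = a then (![0, 0, 1, 0, 1] : Fin 5 → Fin 3) a else if (b : ℕ) = a + 1 then (![2, 0, 0, 0, 0] : Fin 5 → Fin 3) a else if (a : ℕ) = b + 1 then (![2, 0, 0, 0, 0] : Fin 5 → Fin 3) b else 0)) ((Equiv.swap (1 : Fin 5) 2 * Equiv.swap (3 : Fin 5) 4 : Equiv.Perm (Fin 5)) i) i) : Equiv.Perm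 (Fin 5) × (Fin 5 → Fin 3)) = 1 := by decide +kernel
  have sP : termSign (fun (a b : Fin 5) (l : Fin 3) => (if (((b : ℕ) = a ∨ (b : ℕ) = a + 1 ∨ (a : ℕ) = b + 1) ∧ l = (fun a b : Fin 5 => (if (b : ℕ) = a then (![0, 0, 1, 0, 1] : Fin 5 → Fin 3) a else if (b : ℕ) = a + 1 then (![2, 0, 0, 0, 0] : Fin 5 → Fin 3) a else if (a : ℕ) = b + 1 then (![2, 0, 0, 0, 0] : Fin 5 → Fin 3) b else 0)) a b) then (1 : ℤ) else 0)) (((Equiv.swap (0 : Fin 5) 1 : Equiv.Perm (Fin 5)), fun i => (fun a b : Fin 5 => (if (b : ℕ) = a then (![0, 0, 1, 0, 1] : Fin 5 → Fin 3) a else if (b : ℕ) = a + 1 then (![2, 0, 0, 0, 0] : Fin 5 → Fin 3) a else if (a : ℕ) = b + 1 then (![2, 0, 0, 0, 0] : Fin 5 → Fin 3) b else 0)) ((Equiv.swap (0 : Fin 5) 1 : Equiv.Perm (Fin 5)) i) i) : Equiv.Perm (Fin 5) × (Fin 5 → Fin 3)) = -1 := by decide +kernel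
  have hsign : ∀ (θ : ℤ) (p : Equiv.Perm (Fin 5) × (Fin 5 → Fin 3)), IsDominant (![0, 1, 2] : Fin 3 → ℕ) (fun (_ _ : Fin 5) (_ : Fin 3) => (0 : ℤ)) (fun (a b : Fin 5) (l : Fin 3) => (if (((b : ℕ) = a ∨ (b : ℕ) = a + 1 ∨ (a : ℕ) = b + 1) ∧ l = (fun a b : Fin 5 => (if (b : ℕ) = a then (![0, 0, 1, 0, 1] : Fin 5 → Fin 3) a else if (b : ℕ) = a + 1 then (![2, 0, 0, 0, 0] : Fin 5 → Fin 3) a else if (a : ℕ) = b + 1 then (![2, 0, 0, 0, 0] : Fin 5 → Fin 3) b else 0)) a b) then (1 : ℤ) else 0)) θ p → termSign (fun (a b : Fin 5) (l : Fin 3) => (if (((b : ℕ) = a ∨ (b : ℕ) = a + 1 ∨ (a : ℕ) = b + 1) ∧ l = (fun a b : Fin 5 => (if (b : ℕ) = a then (![0, 0, 1, 0, 1] : Fin 5 → Fin 3) a else if (b : ℕ) = a + 1 then (![2, 0, 0, 0, 0] : Fin 5 → Fin 3) a else if (a : ℕ) = b + 1 then (![2, 0, 0, 0, 0] : Fin 5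 → Fin 3) b else 0)) a b) then (1 : ℤ) else 0)) p = if 1 ≤ θ then -1 else 1 := by
    intro θ p hp
    rcases (hclass θ p).1 hp with ⟨h, rfl⟩ | ⟨h, rfl⟩
    · rw [sM, if_neg (by omega)]
    · rw [sP, if_pos h]
  -- (f) the pencil identity
  have hpencil : (∑ l, (X : ℝ[X]) ^ (![0, 1, 2] : Fin 3 → ℕ) l • (patchMatrix 2 (fun (_ _ : Fin 5) (_ : Fin 3) => (0 : ℤ)) (fun (a b : Fin 5) (l : Fin 3) => (if (((b : ℕ) = a ∨ (b : ℕ) = a + 1 ∨ (a : ℕ) = b + 1) ∧ l = (fun a b : Fin 5 => (if (b : ℕ) = a then (![0, 0, 1, 0, 1] : Fin 5 → Fin 3) a else if (b : ℕ) = a + 1 then (![2, 0, 0, 0, 0] : Fin 5 → Fin 3) a else if (a : ℕ) = b + 1 then (![2, 0, 0, 0, 0] : Fin 5 → Fin 3) b else 0)) a b) then (1 : ℤ) else 0)) l).map C) =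
      (ctPath
        (fun t : ℕ => if t = 2 then (X : ℝ[X]) else if t = 4 then (X : ℝ[X]) else (1 : ℝ[X]))
        (fun t : ℕ => if t = 0 then (X ^ 2 : ℝ[X]) else if t = 1 then (1 : ℝ[X]) else if t = 2 then (1 : ℝ[X]) else if t = 3 then (1 : ℝ[X]) else (0 : ℝ[X]))
        (fun t : ℕ => if t = 0 then (0 : ℝ[X]) else if t = 1 then (X ^ 2 : ℝ[X]) else if t = 2 then (1 : ℝ[X]) else if t = 3 then (1 : ℝ[X]) else if t = 4 then (1 : ℝ[X]) else (0 : ℝ[X])) 5) := by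
    refine Matrix.ext fun i j => ?_
    rw [Matrix.sum_apply, ctPath_apply]
    simp only [Matrix.smul_apply, Matrix.map_apply, patchMatrix, smul_eq_mul]
    fin_cases i <;> fin_cases j <;> simp
  refine ⟨?_, ?_, hclass, sM, sP, ?_, ?_, ?_, hpencil, ?_⟩
  · intro i j l
    dsimp only
    split_ifs <;> simp
  · have hε : ∀ (l' : Fin 3) (a b : Fin 5), (fun (a b : Fin 5) (l : Fin 3) => (if (((b : ℕ) = a ∨ (b : ℕ) = a + 1 ∨ (a : ℕ) = b + 1) ∧ l = (fun a b : Fin 5 => (if (b : ℕ) = a then (![0, 0, 1, 0, 1] : Fin 5 → Fin 3) a else if (b : ℕ) = a + 1 then (![2, 0, 0, 0, 0] : Fin 5 → Fin 3) a else if (a : ℕ) = b + 1 then (![2, 0, 0, 0, 0] : Fin 5 → Fin 3) b else 0)) a b) then (1 : ℤ) else 0)) a b l' = (fun (a b : Fin 5) (l : Fin 3) => (if (((b : ℕ) = a ∨ (b : ℕ) = a + 1 ∨ (a : ℕ) = b + 1) ∧ l = (fun a b : Fin 5 => (if (b : ℕ) = a then (![0, 0, 1, 0, 1] : Fin 5 →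 Fin 3) a else if (b : ℕ) = a + 1 then (![2, 0, 0, 0, 0] : Fin 5 → Fin 3) a else if (a : ℕ) = b + 1 then (![2, 0, 0, 0, 0] : Fin 5 → Fin 3) b else 0)) a b) then (1 : ℤ) else 0)) b a l' := by decide +kernel
    beta_reduce at hε
    intro l
    exact Matrix.IsSymm.ext fun a b => by rw [patchMatrix, patchMatrix, hε l b a]
  · -- alternating chains have `n ≤ 1`: only two dominant terms exist, one per side of `0`
    intro n θ p hθ hdom halt
    by_contra hn
    have hn2 : 2 ≤ n := by omega
    have a0 := halt ⟨0, by omega⟩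
    have a1 := halt ⟨1, by omega⟩
    rw [hsign _ _ (hdom _), hsign _ _ (hdom _)] at a0 a1
    have e1 : (Fin.succ (⟨0, by omega⟩ : Fin n)) = Fin.castSucc (⟨1, by omega⟩ : Fin n) := Fin.ext (by simp)
    rw [e1] at a0
    have lt1 : θ (Fin.castSucc (⟨0, by omega⟩ : Fin n)) < θ (Fin.castSucc (⟨1, by omega⟩ : Fin n)) :=
      hθ (by simp [Fin.lt_def])
    have lt2 : θ (Fin.castSucc (⟨1, by omega⟩ : Fin n)) < θ (Fin.succ (⟨1, by omega⟩ : Fin n)) :=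
      hθ (by simp [Fin.lt_def])
    split_ifs at a0 a1 <;> omega
  · refine ⟨![-1, 1], ![(((Equiv.swap (1 : Fin 5) 2 * Equiv.swap (3 : Fin 5) 4 : Equiv.Perm (Fin 5)), fun i => (fun a b : Fin 5 => (if (b : ℕ) = a then (![0, 0, 1, 0, 1] : Fin 5 → Fin 3) a else if (b : ℕ) = a + 1 then (![2, 0, 0, 0, 0] : Fin 5 → Fin 3) a else if (a : ℕ) = b + 1 then (![2, 0, 0, 0, 0] : Fin 5 → Fin 3) b else 0)) ((Equiv.swap (1 : Fin 5) 2 * Equiv.swap (3 : Fin 5) 4 : Equiv.Perm (Fin 5)) i) i) : Equiv.Perm (Fin 5) × (Fin 5 → Fin 3)), (((Equiv.swap (0 : Fin 5) 1 : Equiv.Perm (Fin 5)), fun i => (fun a b : Fin 5 => (if (b : ℕ) = a then (![0, 0, 1, 0, 1] : Fin 5 → Fin 3) a else if (b : ℕ) = a + 1 then (![2, 0, 0, 0, 0] : Fin 5 → Fin 3) a else if (a : ℕ) = b + 1 then (![2, 0, 0, 0, 0] : Fin 5 → Fin 3) b else 0)) ((Equiv.swap (0 : Fin 5) 1 : Equiv.Perm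 (Fin 5)) i) i) : Equiv.Perm (Fin 5) × (Fin 5 → Fin 3))], ?_, ?_, ?_⟩
    · rw [Fin.strictMono_iff_lt_succ]; decide
    · intro k
      fin_cases k
      · exact hminus
      · exact hplus
    · intro k
      fin_cases k
      show termSign (fun (a b : Fin 5) (l : Fin 3) => (if (((b : ℕ) = a ∨ (b : ℕ) = a + 1 ∨ (a : ℕ) = b + 1) ∧ l = (fun a b : Fin 5 => (if (b : ℕ) = a then (![0, 0, 1, 0, 1] : Fin 5 → Fin 3) a else if (b : ℕ) = a + 1 then (![2, 0, 0, 0, 0] : Fin 5 → Fin 3) a else if (a : ℕ) = b + 1 then (![2, 0, 0, 0, 0] : Fin 5 → Fin 3) b else 0)) a b) then (1 : ℤ) else 0)) (((Equiv.swap (1 : Fin 5) 2 * Equiv.swap (3 : Fin 5) 4 : Equiv.Perm (Fin 5)), fun i => (fun a b : Fin 5 => (if (b : ℕ) = a then (![0, 0, 1, 0, 1] : Fin 5 → Fin 3) a else if (b : ℕ) = a + 1 then (![2, 0, 0, 0, 0] : Fin 5 → Fin 3) a else if (a : ℕ) = b + 1 then (![2, 0, 0, 0, 0] : Fin 5 →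 Fin 3) b else 0)) ((Equiv.swap (1 : Fin 5) 2 * Equiv.swap (3 : Fin 5) 4 : Equiv.Perm (Fin 5)) i) i) : Equiv.Perm (Fin 5) × (Fin 5 → Fin 3)) * termSign (fun (a b : Fin 5) (l : Fin 3) => (if (((b : ℕ) = a ∨ (b : ℕ) = a + 1 ∨ (a : ℕ) = b + 1) ∧ l = (fun a b : Fin 5 => (if (b : ℕ) = a then (![0, 0, 1, 0, 1] : Fin 5 → Fin 3) a else if (b : ℕ) = a + 1 then (![2, 0, 0, 0, 0] : Fin 5 → Fin 3) a else if (a : ℕ) = b + 1 then (![2, 0, 0, 0, 0] : Fin 5 → Fin 3) b else 0)) a b) then (1 : ℤ) else 0)) (((Equiv.swap (0 : Fin 5) 1 : Equiv.Perm (Fin 5)), fun i => (fun a b : Fin 5 => (if (b : ℕ) = a then (![0, 0, 1, 0, 1] : Fin 5 → Fin 3) a else if (b : ℕ) = a + 1 then (![2, 0, 0, 0, 0] : Fin 5 → Fin 3) a else if (a : ℕ) = b + 1 then (![2, 0, 0, 0, 0] : Fin 5 → Fin 3) b else 0)) ((Equiv.swap (0 : Fin 5) 1 : Equiv.Perm (Fin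 5)) i) i) : Equiv.Perm (Fin 5) × (Fin 5 → Fin 3)) < 0
      rw [sM, sP]; norm_num
  · -- unsigned row 1
    intro n θ p hθ hdom hne
    by_contra hn
    have hn2 : 2 ≤ n := by omega
    have h01 : p ⟨0, by omega⟩ ≠ p ⟨1, by omega⟩ := hne ⟨0, by omega⟩
    have h12 : p ⟨1, by omega⟩ ≠ p ⟨2, by omega⟩ := hne ⟨1, by omega⟩
    have t01 : θ ⟨0, by omega⟩ < θ ⟨1, by omega⟩ := hθ (Fin.mk_lt_mk.mpr (by norm_num))
    have t12 : θ ⟨1, by omega⟩ < θ ⟨2, by omega⟩ := hθ (Fin.mk_lt_mk.mpr (by norm_num))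
    rcases (hclass _ _).1 (hdom ⟨1, by omega⟩) with ⟨h1, e1⟩ | ⟨h1, e1⟩
    · rcases (hclass _ _).1 (hdom ⟨0, by omega⟩) with ⟨h0, e0⟩ | ⟨h0, e0⟩
      · exact h01 (e0.trans e1.symm)
      · omega
    · rcases (hclass _ _).1 (hdom ⟨2, by omega⟩) with ⟨h2, e2⟩ | ⟨h2, e2⟩
      · omega
      · exact h12 (e1.trans e2.symm)
  · -- three positive zeros of `−X⁶ + 2X⁵ + X² − 3X + 1`: sign changes at `1/4, 1/2, 3/2, 2`
    refine le_card_posRoots_of_alternating _ 3 (![1/4, 1/2, 3/2, 2] : Fin 4 → ℝ) ?_ ?_ ?_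
    · refine Fin.strictMono_iff_lt_succ.2 fun j => ?_
      fin_cases j <;> (simp only [Fin.castSucc_mk, Fin.succ_mk]; norm_num)
    · intro j; fin_cases j <;> (simp; try norm_num)
    · intro j; fin_cases j <;>
        (rw [det_ctPath]; simp [ctK_add_two, ctK_one, ctK_zero]; norm_num)

/-- **SUMMARY**: there is a dominance design of format `(5, 3)` with ALL VALUATIONS ZERO (`|ε| ≤ 1`, symmetric letters) whose dominant terms
are exactly two (one for all `θ ≤ −1`, one for all `θ ≥ 1`; total tie at `0`) — sign-alternating chains `n ≤ 1` (attained), unsigned row `1` —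
and whose base-2 patchwork, a static definite tridiagonal `5 × 5` monomial matrix with all coefficients `1`, has at least `3` positive zeros.
[this file] -/
theorem unit_five_exists :
    ∃ (d : Fin 3 → ℕ) (ε : Fin 5 → Fin 5 → Fin 3 → ℤ),
      (∀ i j l, (ε i j l).natAbs ≤ 1) ∧ (∀ l, (patchMatrix 2 (fun _ _ _ => (0 : ℤ)) ε l).IsSymm) ∧
      (∀ (n : ℕ) (θ : Fin (n + 1) → ℤ) (p : Fin (n + 1) → Equiv.Perm (Fin 5) × (Fin 5 → Fin 3)), StrictMono θ →
        (∀ k, IsDominant d (fun _ _ _ => (0 : ℤ)) ε (θ k) (p k)) →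
        (∀ k : Fin n, termSign ε (p k.castSucc) * termSign ε (p k.succ) < 0) → n ≤ 1) ∧
      (∃ (θ : Fin 2 → ℤ) (p : Fin 2 → Equiv.Perm (Fin 5) × (Fin 5 → Fin 3)), StrictMono θ ∧ (∀ k, IsDominant d (fun _ _ _ => (0 : ℤ)) ε (θ k) (p k)) ∧
        (∀ k : Fin 1, termSign ε (p k.castSucc) * termSign ε (p k.succ) < 0)) ∧
      DesignRowD d (fun _ _ _ => (0 : ℤ)) ε 1 ∧
      3 ≤ ((∑ l, (X : ℝ[X]) ^ d l • (patchMatrix 2 (fun _ _ _ => (0 : ℤ)) ε l).map C).det.roots.toFinset.filter (fun t => 0 < t)).card := by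
  obtain ⟨h1, h2, -, -, -, h6, h7, h8, h9, h10⟩ := unit_five
  refine ⟨_, _, h1, h2, h6, h7, h8, ?_⟩
  rw [h9]
  exact h10

end Summit.ValiantsHypothesis.ValiantsHypothesis.Theorems.KPlusLogSqLaw.StaticTridiagonalRealUnitShadow
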